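import Mathlib
import Summits.NavierStokesRegularity.NavierStokesRegularity.Theorems.HeteroclinicTriggerChainTriggerChainFrontStepTruncDelayCore
import Summits.NavierStokesRegularity.NavierStokesRegularity.Theorems.TaoLadderRungThreeGappedFrontRobustComparison
import HarnessLib

/-!
# `HeteroclinicTriggerChain` — crux `TriggerChainFrontStep` (item stmt-NavierStokesRegularity-22785):
  the DELAY PHASE of the hop in the seeded two-shell truncation (saddle passage with centre drift)

Second brick of the hop-map analysis (blueprint item 2 of the lead prover's card
`Cruxes/TriggerChainFrontStep/Lines/gapdata_v2.md`; layer-2 child C₁ of the route text) on the seeded two-shell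
truncation of the pinned table `α₀ + βσ` — carrier `x`, trigger `u`, receiver `y`, upper trigger `v`; rates
`e, g > 0` at the front shell, `e' ≥ 0` at the next shell, seed `β ≥ 0`:
`x′ = −eu² − βuv`, `u′ = exu − guy`, `y′ = gu² − e′v²`, `v′ = βxu + e′yv` (energy-conserving; the system of
`…TriggerChainFrontStepSeededTruncation`, whose trigger formula and energy identity are used here).

THE DELAY PHASE. From a restart state of energy `≤ 1` with a small positive trigger `u(0)`, a receiver residue
`y(0) ≥ 0` and an upper trigger `v(0) ≥ 0`, consider any window `[0, T]` on which the trigger has not yet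
ignited, `u ≤ h`. This is the passage near the pure-mode saddle `(1, 0, 0, 0)`, whose unstable rate is `e`
(the trigger) and whose CENTRE directions are the receiver residue `y` and the upper trigger `v` (critic
idea-crit-3 on this route, prices P1/P4: "the passage lemma WITH its centre-drift term"). We prove
(`heteroclinicTriggerChain_trunc_delayPhase`), by a continuity argument over the window (the cell's
`GappedFrontRobust.bootstrap_family` on the pair `(1 − x, y)`) and integrating-factor monotonicity identities
(no appeal to ODE uniqueness, no integrals beyond the factor `exp(−∫e′y)`):
* carrier drift `1 − δ₁ ≤ x ≤ 1`, `δ₁ = (1 − x(0)) + h² + 2βVh/e`;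
* receiver drift `y(0) ≤ y ≤ δ₂`, `δ₂ = y(0) + gh²/e` — the receiver is NON-DECREASING in the delay phase:
  the pump `gu²` beats the upper drain `e′v²` as long as `16 e′β² e^{4Λ} ≤ g e²` and
  `4 e′ e^{4Λ} v(0)² ≤ g u(0)²`;
* upper-trigger (centre) drift `0 ≤ v ≤ e^{2Λ} (v(0) + 2βu/e) ≤ V`, where `Λ ≥ e′ δ₂ T` books the
  amplification of the seed by the receiver residue over the window (the premature-ignition mechanism seen in
  the route's numerics, kit j291070/j291331), and the seed collected so far, `v ≥ v(0) + β(1 − δ₁)(u − u(0))/e`;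
* the two-sided exponential law `u(0) e^{e(1−ε)s} ≤ u(s) ≤ u(0) e^{es}`, `ε = δ₁ + gδ₂/e ≤ 1/4`, hence the
  IGNITION-TIME LAW (`heteroclinicTriggerChain_trunc_ignitionTime`): a window with `u ≤ h` is no longer than
  `log(h/u(0)) / (e(1 − ε))`, and `u(T) = h` forces `T ≥ log(h/u(0))/e`.
The smallness hypothesis is `2δ₁ + 2gδ₂/e ≤ 1/2`. The scalar tools (`htcTP_exp_growth_lower/upper`, the four
window estimates `htcTP_upper_nonneg`, `htcTP_upper_bound`, `htcTP_receiver_window`, `htcTP_carrier_window`,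
`htcTP_seed_window`) are stated for an abstract rate `u′ = r u` so that they can be re-used on the lattice.

HONEST FRAMING: elementary facts about a four-dimensional quadratic ODE (a MODEL truncation of Tao's lattice,
Tao 2016 §4); helper lemmas for the crux, no stub credit; nothing here is a statement about the Navier–Stokes
equations; no summit, rung or crux is proved. NS regularity is not proved by this line.
-/

noncomputable section

-- the sub-problem namespace `Summit.NavierStokesRegularity.NavierStokesRegularity` repeats the summit name by design (D-0017)
set_option linter.dupNamespace false

open Real Set

namespace Summit.NavierStokesRegularity.NavierStokesRegularity.Theorems

/-! ### The delay phase on a window `[0, T]` with `u ≤ h` (bootstrap) -/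

/-- **DELAY PHASE OF THE HOP (saddle passage with centre drift) in the seeded two-shell truncation**
`x′ = −eu² − βuv`, `u′ = exu − guy`, `y′ = gu² − e′v²`, `v′ = βxu + e′yv` (`e, g > 0`, `e′, β ≥ 0`),
helper for item stmt-NavierStokesRegularity-22785. From a state of energy `≤ 1` with `u(0) > 0`,
`y(0), v(0) ≥ 0`, on every window `[0, T]` on which the trigger has not ignited (`u ≤ h`), and for
constants `δ₂ ≥ y(0) + gh²/e` (receiver drift), `Λ ≥ e′δ₂T` (amplification budget of the window),
`V ≥ e^{2Λ}(v(0) + 2βh/e)` (upper-trigger ceiling), `δ₁ ≥ 1 − x(0) + h² + 2βVh/e` (carrier drift) with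
`2δ₁ + 2gδ₂/e ≤ 1/2`, `4e′e^{4Λ}v(0)² ≤ g u(0)²` and `16 e′β²e^{4Λ} ≤ g e²` (pump beats drain), we have
throughout the window: `1 − δ₁ ≤ x ≤ 1`; `y(0) ≤ y ≤ δ₂` (receiver non-decreasing);
`0 ≤ v ≤ e^{2Λ}(v(0) + 2βu/e)`; the two-sided exponential law
`u(0) e^{e(1−ε)s} ≤ u(s) ≤ u(0) e^{es}`, `ε = δ₁ + gδ₂/e`; and the collected seed
`v ≥ v(0) + β(1−δ₁)(u − u(0))/e`. Proof: continuity argument (`GappedFrontRobust.bootstrap_family`) on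
the pair `(1 − x, y)` with the core step `heteroclinicTriggerChain_trunc_delay_core`. [folklore] -/
theorem heteroclinicTriggerChain_trunc_delayPhase (e g e' β : ℝ) (he : 0 < e) (hg : 0 < g)
    (he' : 0 ≤ e') (hβ : 0 ≤ β) (x u y v : ℝ → ℝ)
    (hx : ∀ t, HasDerivAt x (-(e * u t ^ 2) - β * u t * v t) t)
    (hu : ∀ t, HasDerivAt u (e * x t * u t - g * u t * y t) t)
    (hy : ∀ t, HasDerivAt y (g * u t ^ 2 - e' * v t ^ 2) t)
    (hv : ∀ t, HasDerivAt v (β * x t * u t + e' * y t * v t) t)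
    (hE : x 0 ^ 2 + u 0 ^ 2 + y 0 ^ 2 + v 0 ^ 2 ≤ 1)
    (hu0 : 0 < u 0) (hy0 : 0 ≤ y 0) (hv0 : 0 ≤ v 0)
    {T h Λ δ₁ δ₂ V : ℝ} (hT : 0 ≤ T)
    (hδ₂ : y 0 + g * h ^ 2 / e ≤ δ₂) (hΛT : e' * δ₂ * T ≤ Λ)
    (hV : Real.exp (2 * Λ) * (v 0 + 2 * β * h / e) ≤ V)
    (hδ₁ : 1 - x 0 + h ^ 2 + 2 * β * V * h / e ≤ δ₁)
    (hsmall : 2 * δ₁ + 2 * g * δ₂ / e ≤ 1 / 2)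
    (hv0u0 : 4 * e' * Real.exp (4 * Λ) * v 0 ^ 2 ≤ g * u 0 ^ 2)
    (hβe : 16 * e' * β ^ 2 * Real.exp (4 * Λ) ≤ g * e ^ 2)
    (huh : ∀ s ∈ Icc 0 T, u s ≤ h) :
    ∀ s ∈ Icc 0 T,
      1 - δ₁ ≤ x s ∧ x s ≤ 1 ∧ y 0 ≤ y s ∧ y s ≤ δ₂ ∧ 0 < u s ∧ 0 ≤ v s ∧
      v s ≤ Real.exp (2 * Λ) * (v 0 + 2 * β * u s / e) ∧
      u 0 * Real.exp (e * (1 - (δ₁ + g * δ₂ / e)) * s) ≤ u s ∧ u s ≤ u 0 * Real.exp (e * s) ∧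
      v 0 + β * (1 - δ₁) * (u s - u 0) / e ≤ v s := by
  have h0mem : (0 : ℝ) ∈ Icc 0 T := left_mem_Icc.2 hT
  have hhpos : 0 < h := lt_of_lt_of_le hu0 (huh 0 h0mem)
  have hδ₂pos : 0 < δ₂ := by
    have : 0 < g * h ^ 2 / e := by positivity
    linarith
  -- energy ≤ 1 everywhere, hence all four coordinates have modulus ≤ 1
  have hEs : ∀ s, x s ^ 2 + u s ^ 2 + y s ^ 2 + v s ^ 2 ≤ 1 := fun s => by
    rw [heteroclinicTriggerChain_trunc_energy e g e' β x u y v hx hu hy hv s]; exact hE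
  have hu2 : ∀ s, u s ^ 2 ≤ 1 := fun s => by
    nlinarith [hEs s, sq_nonneg (x s), sq_nonneg (y s), sq_nonneg (v s)]
  have hv2 : ∀ s, v s ^ 2 ≤ 1 := fun s => by
    nlinarith [hEs s, sq_nonneg (x s), sq_nonneg (y s), sq_nonneg (u s)]
  have huv : ∀ s, |u s * v s| ≤ 1 := fun s => by
    have h1 : |u s| ≤ 1 := (sq_le_one_iff_abs_le_one (u s)).1 (hu2 s)
    have h2 : |v s| ≤ 1 := (sq_le_one_iff_abs_le_one (v s)).1 (hv2 s)
    rw [abs_mul]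
    nlinarith [abs_nonneg (u s), abs_nonneg (v s)]
  have hx0le : x 0 ≤ 1 := by
    nlinarith [hEs 0, sq_nonneg (u 0), sq_nonneg (y 0), sq_nonneg (v 0), sq_nonneg (x 0 - 1)]
  have hVnn : 0 ≤ V := le_trans (by positivity) hV
  have hδ₁pos : 0 < δ₁ := by
    have h1 : 0 < h ^ 2 := by positivity
    have h2 : 0 ≤ 2 * β * V * h / e := by positivity
    linarith
  -- Lipschitz bounds from the equations of motion
  have hxlip : ∀ s t : ℝ, |x t - x s| ≤ (e + β) * |t - s| := by
    intro s t
    have hb : ∀ z ∈ (univ : Set ℝ), ‖-(e * u z ^ 2) - β * u z * v z‖ ≤ e + β := by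
      intro z _
      rw [Real.norm_eq_abs, abs_le]
      have h2 := huv z
      have h3 : β * (u z * v z) ≤ β * 1 := mul_le_mul_of_nonneg_left ((le_abs_self _).trans h2) hβ
      have h4 : β * (-(u z * v z)) ≤ β * 1 := mul_le_mul_of_nonneg_left ((neg_le_abs _).trans h2) hβ
      have h5 : 0 ≤ e * u z ^ 2 := mul_nonneg he.le (sq_nonneg _)
      have h6 : e * u z ^ 2 ≤ e * 1 := mul_le_mul_of_nonneg_left (hu2 z) he.le
      constructor <;> linarith
    have h := (convex_univ).norm_image_sub_le_of_norm_hasDerivWithin_le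
      (fun z _ => (hx z).hasDerivWithinAt) hb (mem_univ s) (mem_univ t)
    simpa [Real.norm_eq_abs] using h
  have hylip : ∀ s t : ℝ, |y t - y s| ≤ (g + e') * |t - s| := by
    intro s t
    have hb : ∀ z ∈ (univ : Set ℝ), ‖g * u z ^ 2 - e' * v z ^ 2‖ ≤ g + e' := by
      intro z _
      rw [Real.norm_eq_abs, abs_le]
      have h3 : 0 ≤ g * u z ^ 2 := mul_nonneg hg.le (sq_nonneg _)
      have h4 : 0 ≤ e' * v z ^ 2 := mul_nonneg he' (sq_nonneg _)
      have h5 : g * u z ^ 2 ≤ g * 1 := mul_le_mul_of_nonneg_left (hu2 z) hg.le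
      have h6 : e' * v z ^ 2 ≤ e' * 1 := mul_le_mul_of_nonneg_left (hv2 z) he'
      constructor <;> linarith
    have h := (convex_univ).norm_image_sub_le_of_norm_hasDerivWithin_le
      (fun z _ => (hy z).hasDerivWithinAt) hb (mem_univ s) (mem_univ t)
    simpa [Real.norm_eq_abs] using h
  have hx0δ : 1 - x 0 ≤ δ₁ := by
    have h1 : 0 ≤ h ^ 2 := sq_nonneg h
    have h2 : 0 ≤ 2 * β * V * h / e := by positivity
    linarith
  have hy0δ : y 0 ≤ δ₂ := by
    have h1 : 0 ≤ g * h ^ 2 / e := by positivity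
    linarith
  -- the bootstrap on the pair (1 − x, y)
  set L : ℝ := (e + β) / δ₁ + (g + e') / δ₂ with hL
  have hLnn : 0 ≤ L := by positivity
  have hLδ₁ : e + β ≤ L * δ₁ := by
    have h1 : L * δ₁ = (e + β) + (g + e') / δ₂ * δ₁ := by
      rw [hL]; field_simp
    have h2 : 0 ≤ (g + e') / δ₂ * δ₁ := by positivity
    linarith
  have hLδ₂ : g + e' ≤ L * δ₂ := by
    have h1 : L * δ₂ = (e + β) / δ₁ * δ₂ + (g + e') := by
      rw [hL]; field_simp
    have h2 : 0 ≤ (e + β) / δ₁ * δ₂ := by positivity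
    linarith
  have key := GappedFrontRobust.bootstrap_family (ι := Fin 2)
    (u := ![fun s => 1 - x s, fun s => y s]) (p := ![δ₁, δ₂]) (ψ := fun _ => (1 : ℝ)) (τ := T) (L := L)
    (by intro j; fin_cases j <;> simp <;> linarith) hLnn continuousOn_const (fun _ _ => one_pos)
    (by
      intro j s _ t _
      fin_cases j
      · simp only [Fin.zero_eta, Fin.isValue, Matrix.cons_val_zero]
        have h1 : |1 - x t - (1 - x s)| = |x t - x s| := by
          rw [show (1 : ℝ) - x t - (1 - x s) = -(x t - x s) by ring, abs_neg]
        rw [h1]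
        exact (hxlip s t).trans (mul_le_mul_of_nonneg_right hLδ₁ (abs_nonneg _))
      · simp only [Fin.mk_one, Fin.isValue, Matrix.cons_val_one, Matrix.cons_val_fin_one]
        exact (hylip s t).trans (mul_le_mul_of_nonneg_right hLδ₂ (abs_nonneg _)))
    (by intro j; fin_cases j <;> simp <;> linarith)
    (by
      intro t ht hweak j
      have hwx : ∀ s ∈ Icc 0 t, 1 - 2 * δ₁ ≤ x s := fun s hs => by
        have := hweak 0 s hs
        simp at this
        linarith
      have hwy : ∀ s ∈ Icc 0 t, y s ≤ 2 * δ₂ := fun s hs => by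
        have := hweak 1 s hs
        simp at this
        linarith
      have hΛt : e' * δ₂ * t ≤ Λ := le_trans (mul_le_mul_of_nonneg_left ht.2 (by positivity)) hΛT
      have hc := heteroclinicTriggerChain_trunc_delay_core e g e' β he hg.le he' hβ x u y v hx hu hy hv
        hE hu0 hy0 hv0 hδ₂ hΛt hV hδ₁ hsmall hv0u0 hβe (fun s hs => huh s ⟨hs.1, hs.2.trans ht.2⟩)
        hwx hwy t ⟨ht.1, le_rfl⟩
      fin_cases j
      · simp
        linarith [hc.1]
      · simp
        linarith [hc.2.2.2.1])
  -- strong bounds on the whole window, then the core step once more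
  have hsx : ∀ s ∈ Icc 0 T, 1 - 2 * δ₁ ≤ x s := fun s hs => by
    have := key 0 s hs
    simp at this
    linarith
  have hsy : ∀ s ∈ Icc 0 T, y s ≤ 2 * δ₂ := fun s hs => by
    have := key 1 s hs
    simp at this
    linarith
  exact heteroclinicTriggerChain_trunc_delay_core e g e' β he hg.le he' hβ x u y v hx hu hy hv hE hu0 hy0
    hv0 hδ₂ hΛT hV hδ₁ hsmall hv0u0 hβe huh hsx hsy

/-- **IGNITION-TIME LAW of the delay phase** (the `log(1/seed)/e` delay with its drift correction; helper
for item stmt-NavierStokesRegularity-22785). In the setting of `heteroclinicTriggerChain_trunc_delayPhase`: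
a window `[0, T]` on which the trigger stays below the ignition level `h` is no longer than
`log(h/u(0)) / (e(1 − ε))`, `ε = δ₁ + gδ₂/e ≤ 1/4`; and if the trigger reaches `h` at time `T` then
`T ≥ log(h/u(0))/e`. Compare the exact arc's half-transfer delay
`|T½ − log(1/|u₀|)/e| ≤ log 2/(2e)` (`heteroclinicTriggerChain_arc_halfTransfer_delay`). [folklore] -/
theorem heteroclinicTriggerChain_trunc_ignitionTime (e g e' β : ℝ) (he : 0 < e) (hg : 0 < g)
    (he' : 0 ≤ e') (hβ : 0 ≤ β) (x u y v : ℝ → ℝ)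
    (hx : ∀ t, HasDerivAt x (-(e * u t ^ 2) - β * u t * v t) t)
    (hu : ∀ t, HasDerivAt u (e * x t * u t - g * u t * y t) t)
    (hy : ∀ t, HasDerivAt y (g * u t ^ 2 - e' * v t ^ 2) t)
    (hv : ∀ t, HasDerivAt v (β * x t * u t + e' * y t * v t) t)
    (hE : x 0 ^ 2 + u 0 ^ 2 + y 0 ^ 2 + v 0 ^ 2 ≤ 1)
    (hu0 : 0 < u 0) (hy0 : 0 ≤ y 0) (hv0 : 0 ≤ v 0)
    {T h Λ δ₁ δ₂ V : ℝ} (hT : 0 ≤ T)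
    (hδ₂ : y 0 + g * h ^ 2 / e ≤ δ₂) (hΛT : e' * δ₂ * T ≤ Λ)
    (hV : Real.exp (2 * Λ) * (v 0 + 2 * β * h / e) ≤ V)
    (hδ₁ : 1 - x 0 + h ^ 2 + 2 * β * V * h / e ≤ δ₁)
    (hsmall : 2 * δ₁ + 2 * g * δ₂ / e ≤ 1 / 2)
    (hv0u0 : 4 * e' * Real.exp (4 * Λ) * v 0 ^ 2 ≤ g * u 0 ^ 2)
    (hβe : 16 * e' * β ^ 2 * Real.exp (4 * Λ) ≤ g * e ^ 2)
    (huh : ∀ s ∈ Icc 0 T, u s ≤ h) :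
    T ≤ Real.log (h / u 0) / (e * (1 - (δ₁ + g * δ₂ / e))) ∧
      (u T = h → Real.log (h / u 0) / e ≤ T) := by
  have hTmem : T ∈ Icc 0 T := ⟨hT, le_rfl⟩
  obtain ⟨-, -, -, -, -, -, -, hlow, hup, -⟩ :=
    heteroclinicTriggerChain_trunc_delayPhase e g e' β he hg he' hβ x u y v hx hu hy hv hE hu0 hy0 hv0 hT
      hδ₂ hΛT hV hδ₁ hsmall hv0u0 hβe huh T hTmem
  have hhpos : 0 < h := lt_of_lt_of_le hu0 (huh 0 (left_mem_Icc.2 hT))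
  have hδ₂nn : 0 ≤ δ₂ := by
    have : 0 ≤ g * h ^ 2 / e := by positivity
    linarith
  have hεpos : 0 < 1 - (δ₁ + g * δ₂ / e) := by
    have h1 : δ₁ + g * δ₂ / e ≤ 1 / 4 := by
      have h2 : 2 * (δ₁ + g * δ₂ / e) = 2 * δ₁ + 2 * g * δ₂ / e := by ring
      linarith
    linarith
  have hrate : 0 < e * (1 - (δ₁ + g * δ₂ / e)) := mul_pos he hεpos
  have hquot : 0 < h / u 0 := div_pos hhpos hu0
  constructor
  · -- u(0) e^{e(1−ε)T} ≤ u(T) ≤ h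
    have h1 : Real.exp (e * (1 - (δ₁ + g * δ₂ / e)) * T) ≤ h / u 0 := by
      rw [le_div_iff₀ hu0]
      have := huh T hTmem
      nlinarith
    have h2 : e * (1 - (δ₁ + g * δ₂ / e)) * T ≤ Real.log (h / u 0) :=
      (Real.le_log_iff_exp_le hquot).2 h1
    rw [le_div_iff₀ hrate]
    linarith
  · intro hTh
    -- h = u(T) ≤ u(0) e^{eT}
    have h1 : h / u 0 ≤ Real.exp (e * T) := by
      rw [div_le_iff₀ hu0]
      nlinarith [hup]
    have h2 : Real.log (h / u 0) ≤ e * T := by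
      have := Real.log_le_log hquot h1
      rwa [Real.log_exp] at this
    rw [div_le_iff₀ he]
    linarith

end Summit.NavierStokesRegularity.NavierStokesRegularity.Theorems

end
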